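import Literature.NumberTheory.Transcendental.ManyCurveThetaFibreCount
import Literature.NumberTheory.Transcendental.ManyCurveThetaTransport
import Literature.NumberTheory.Transcendental.ManyCurveClosing
import Literature.NumberTheory.Transcendental.ThetaSubgroupClassificationGeneral
import HarnessLib

/-!
# Classification of the `Θ`-closed irreducible subgroups of the `k`-lattice standard models, and the discharge of `HuberWustholzManyCurvePeriods`

Topic `Literature/NumberTheory/Transcendental`; unit
`provefact-Literature.NumberTheory.Transcendental.H-0a3eb64689`. It introduces NO named fact and
DISCHARGES the named fact `Literature.NumberTheory.Transcendental.HuberWustholzManyCurvePeriods`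
(`ManyCurvePeriods.lean`; Huber–Wüstholz, Cambridge Tract 227, Thm. 15.3 (1) for
`M = [ℤ →⁰ 𝔾ₘ] × E₁ × ⋯ × E_k`, pairwise non-isogenous curves): `HuberWustholzManyCurvePeriods_holds`.

The last brick is the lattice-family counterpart of the one-lattice
`ThetaSubgroupClassificationGeneral.lean`: in the theta model of `ManyCurveTheta.lean` (lattice
family `L : 𝓙 → PeriodPair` of PAIRWISE NON-ISOGENOUS lattices, class map `cls : γ → 𝓙` whose CM
classes carry one block) every closed irreducible additive subgroup `H ⊆ V = Lie M_κ,ℂ` for the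
`Θ`-topology is `exp⁻¹(G')` for the explicit connected algebraic subgroup datum `K = linData H`
(`A` = rational relations of the torus directions, `C = zRelCls z'(𝒯(H))` = the CLASSWISE rational
relations of the abelian projection — block-diagonal —, `Ξ` = annihilator of the vector
directions), with `Lie G' = 𝒯(H)` and `dim G' + 1 ≤ coneDim H` (`classification`; saturation
`ratHullCls z'(𝒯(H)) = z'(𝒯(H))` of `ManyCurveThetaFibreCount.lean`, compatibility and splitting of
`ManyCurveThetaLineality.lean`, definability of `ManyCurveThetaTransport.lean`).

Assembly: `classification` is the hypothesis `hCL` of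
`GaGmEFam.Std.philippon_shape_of_classification'` (`ManyCurveThetaModel.lean`), which yields
Philippon's zero estimate for the family theta model (`philippon_family`) = the hypothesis
`hphil` of `HuberWustholzManyCurvePeriods_of_philippon` (`ManyCurveClosing.lean`: Baker–Wüstholz
analytic subgroup theorem for `V × E₁^{n₁} × ⋯ × E_k^{n_k}`, reduction of the period relations).

## References

* A. Huber, G. Wüstholz, *Transcendence and Linear Relations of 1-Periods*, Cambridge Tracts 227,
  CUP 2022, Thm. 15.3 (1), Thm. 6.2. [HuberWustholz2022]
* P. Philippon, *Lemmes de zéros dans les groupes algébriques commutatifs*, Bull. Soc. Math.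
  France 114 (1986), 355–383, Thm. 2.1. [Philippon1986]
* Yu. V. Nesterenko, P. Philippon (eds.), *Introduction to Algebraic Independence Theory*,
  LNM 1752, Springer 2001, Ch. 11 (D. Roy), Thm. 4.1. [NesterenkoPhilippon2001]
* A. Baker, G. Wüstholz, *Logarithmic Forms and Diophantine Geometry*, CUP 2007, Thm. 6.1.
  [BakerWustholz2007]
-/

noncomputable section

open Complex MvPolynomial Module
open scoped PeriodPair

namespace Literature.NumberTheory.Transcendental

namespace GaGmEFam

namespace Std

open GaGmE (Kbar)
open GaGmE.Std (iy iz is coords coords_iy coords_iz coords_is coords_add coords_yPart_zPart_sPart yPart zPart sPart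
  ThetaIdx yDir sDir zProj mem_yDir_iff mem_sDir_iff kappaVec intVec yRelQ mem_yRelQ_iff mem_of_forall_dotPerp
  pureData exists_int_multiple sAnn mem_sAnn_iff yPart_coords_eq sPart_coords_eq)

variable {𝓙 : Type} [Fintype 𝓙] [DecidableEq 𝓙] {β γ δ : Type} [Fintype β] [Fintype γ] [Fintype δ] [DecidableEq γ]
variable (L : 𝓙 → PeriodPair) (cls : γ → 𝓙) (κM : δ → γ → Kbar)

/-! ### Classwise saturated subspaces are spanned by their classwise integer vectors -/

omit [Fintype 𝓙] [DecidableEq γ] in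
variable {L κM} in
/-- A subspace cut out by its classwise rational relations contains the class restrictions of its
vectors. [folklore] -/
theorem restrC_mem_of_ratHullCls_eq {𝔷 : Submodule ℂ (γ → ℂ)} (h𝔷 : KronFam.ratHullCls cls 𝔷 = 𝔷)
    {z : γ → ℂ} (hz : z ∈ 𝔷) (i : 𝓙) : (fun b => if cls b = i then z b else 0) ∈ 𝔷 := by
  rw [← h𝔷, KronFam.mem_ratHullCls_iff]
  intro j c hc hcj
  by_cases hij : j = i
  · subst hij
    rw [← hc z hz]
    refine Finset.sum_congr rfl fun b _ => ?_
    by_cases hb : cls b = j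
    · rw [if_pos hb]
    · rw [if_neg hb, hcj b hb, Rat.cast_zero, zero_mul, zero_mul]
  · refine Finset.sum_eq_zero fun b _ => ?_
    by_cases hb : cls b = i
    · rw [hcj b (hb ▸ Ne.symm hij), Rat.cast_zero, zero_mul]
    · rw [if_neg hb, mul_zero]

omit [DecidableEq γ] in
variable {L κM} in
/-- **A subspace cut out by its classwise rational relations is spanned by its integer vectors
supported in single classes.** [folklore] -/
theorem le_span_intVec_of_ratHullCls_eq {𝔷 : Submodule ℂ (γ → ℂ)} (h𝔷 : KronFam.ratHullCls cls 𝔷 = 𝔷) :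
    𝔷 ≤ Submodule.span ℂ (intVec '' {v : γ → ℤ | intVec v ∈ 𝔷 ∧ ∃ i, ∀ b, cls b ≠ i → v b = 0}) := by
  intro z hz
  have hz' : z ∈ KronFam.ratHullCls cls 𝔷 := KronFam.le_ratHullCls cls 𝔷 hz
  rw [KronFam.mem_ratHullCls_iff] at hz'
  -- base change over the classwise rational relations
  have hspan := Rat.mem_span_ratVec_of_forall_sum_eq_zero
    {c : γ → ℚ | c ∈ Kron.zRel 𝔷 ∧ ∃ i : 𝓙, ∀ b, cls b ≠ i → c b = 0} (x := z)
    (fun c hc => by obtain ⟨hc, i, hci⟩ := hc; exact hz' i c hc hci)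
  refine (Submodule.span_le.mpr ?_) hspan
  rintro _ ⟨v, hv, rfl⟩
  -- `ratVec v ∈ 𝔷`, and so are its class restrictions; each is a rational multiple of an integer vector
  have hvmem : Rat.ratVec v ∈ 𝔷 := by
    rw [← h𝔷, KronFam.mem_ratHullCls_iff]
    intro i c hc hci
    have := hv c ⟨hc, i, hci⟩
    have h' : ((∑ b, c b * v b : ℚ) : ℂ) = 0 := by rw [this]; simp
    push_cast at h'
    simpa [Rat.ratVec] using h'
  have hdec : Rat.ratVec v = ∑ i, Rat.ratVec (restr cls i v) := by
    funext b
    rw [Finset.sum_apply]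
    simp only [Rat.ratVec_apply]
    have h : v b = ∑ i, restr cls i v b := by
      conv_lhs => rw [← sum_restr cls v]
      simp only [Finset.sum_apply]
    rw [h, Rat.cast_sum]
  rw [SetLike.mem_coe, hdec]
  refine Submodule.sum_mem _ fun i _ => ?_
  have himem : Rat.ratVec (restr cls i v) ∈ 𝔷 := by
    have h := restrC_mem_of_ratHullCls_eq cls h𝔷 hvmem i
    convert h using 1
    funext b
    rw [Rat.ratVec_apply, cast_restr, Rat.ratVec_apply]
  obtain ⟨d, w, hd, hw⟩ := exists_int_multiple (restr cls i v)
  have hwv : intVec w = (d : ℂ) • Rat.ratVec (restr cls i v) := by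
    funext b
    simp only [intVec, Pi.smul_apply, smul_eq_mul, Rat.ratVec_apply]
    have := hw b
    have h' : ((w b : ℚ) : ℂ) = ((d * restr cls i v b : ℚ) : ℂ) := by rw [this]
    push_cast at h'
    exact h'
  have hwmem : intVec w ∈ 𝔷 := by rw [hwv]; exact Submodule.smul_mem _ _ himem
  have hwcls : ∀ b, cls b ≠ i → w b = 0 := by
    intro b hb
    have := hw b
    rw [restr_apply_of_ne cls hb, mul_zero] at this
    exact_mod_cast this
  have hdC : (d : ℂ) ≠ 0 := by exact_mod_cast hd
  have : Rat.ratVec (restr cls i v) = (d : ℂ)⁻¹ • intVec w := by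
    rw [hwv, smul_smul, inv_mul_cancel₀ hdC, one_smul]
  rw [this]
  exact Submodule.smul_mem _ _ (Submodule.subset_span ⟨w, ⟨hwmem, i, hwcls⟩, rfl⟩)

/-! ### The datum of a closed irreducible subgroup -/

section Model

variable {N : ℕ} (M : AnalyticGroupModel (β ⊕ (γ ⊕ δ) → ℂ) N) (e : Option β × ThetaIdx γ δ ≃ Fin (N + 1))
variable (hΘ : ∀ J w, M.Θ (e J) w = theta L cls κM J w)
include hΘ

/-- **Compatibility and splitting for a closed irreducible subgroup** (no CM): for every `ζ` in
the abelian projection of `𝒯(H)`, `(0,0,κζ) ∈ 𝒯(H)` and `(0,ζ,0) ∈ 𝒯(H)`. [folklore] -/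
theorem kappaVec_mem_and_zEmb_mem_of_isIrred (hiso : ∀ i j, i ≠ j → ¬ (L i).IsIsogenousTo (L j))
    (hcm1 : ∀ b b', cls b = cls b' → (L (cls b)).HasCM → b = b') {H : AddSubgroup (β ⊕ (γ ⊕ δ) → ℂ)}
    (hH : M.IsIrred (H : Set (β ⊕ (γ ⊕ δ) → ℂ))) {ζ : γ → ℂ}
    (hζ : ζ ∈ (AnalyticGroupModel.linSpace (H : Set (β ⊕ (γ ⊕ δ) → ℂ))).map zProj) :
    coords (0 : β → ℂ) (0 : γ → ℂ) (kappaVec κM ζ) ∈ AnalyticGroupModel.linSpace (H : Set (β ⊕ (γ ⊕ δ) → ℂ)) ∧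
      coords (0 : β → ℂ) ζ (0 : δ → ℂ) ∈ AnalyticGroupModel.linSpace (H : Set (β ⊕ (γ ⊕ δ) → ℂ)) :=
  kappaVec_mem_and_zEmb_mem L cls κM M e hΘ hH.isClosedG {v : γ → ℤ | intVec v ∈
      (AnalyticGroupModel.linSpace (H : Set (β ⊕ (γ ⊕ δ) → ℂ))).map zProj ∧ ∃ i, ∀ b, cls b ≠ i → v b = 0}
    (fun _ hv => hv.2) (fun _ hv => hv.1)
    (le_span_intVec_of_ratHullCls_eq cls (ratHullCls_zProj_linSpace_eq L cls κM M e hΘ hiso hcm1 hH)) hζ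

end Model

/-- **The algebraic subgroup datum of a closed irreducible subgroup `H`** (no CM):
`A = yRelQ (yDir 𝒯(H))`, `C = zRel z'(𝒯(H))`, `Ξ = sAnn (sDir 𝒯(H))`. [folklore] -/
def linData {N : ℕ} (M : AnalyticGroupModel (β ⊕ (γ ⊕ δ) → ℂ) N) (e : Option β × ThetaIdx γ δ ≃ Fin (N + 1))
    (hΘ : ∀ J w, M.Θ (e J) w = theta L cls κM J w) (hiso : ∀ i j, i ≠ j → ¬ (L i).IsIsogenousTo (L j))
    (hcm1 : ∀ b b', cls b = cls b' → (L (cls b)).HasCM → b = b') {H : AddSubgroup (β ⊕ (γ ⊕ δ) → ℂ)}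
    (hH : M.IsIrred (H : Set (β ⊕ (γ ⊕ δ) → ℂ))) : SubgroupDataC β γ δ cls κM where
  A := yRelQ (yDir (AnalyticGroupModel.linSpace (H : Set (β ⊕ (γ ⊕ δ) → ℂ))))
  C := zRelCls cls ((AnalyticGroupModel.linSpace (H : Set (β ⊕ (γ ⊕ δ) → ℂ))).map zProj)
  blockDiag := isBlockDiag_zRelCls cls _
  Ξ := sAnn (sDir (AnalyticGroupModel.linSpace (H : Set (β ⊕ (γ ⊕ δ) → ℂ))))
  compat ξ hξ := by
    classical
    set 𝔥 := AnalyticGroupModel.linSpace (H : Set (β ⊕ (γ ⊕ δ) → ℂ)) with h𝔥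
    set 𝔷₀ := 𝔥.map zProj with h𝔷₀
    set r : γ → ℂ := fun b => ∑ e', ξ e' * (κM e' b : ℂ) with hr
    -- `r` kills `𝔷₀`
    have hr0 : ∀ ζ ∈ 𝔷₀, ∑ b, r b * ζ b = 0 := by
      intro ζ hζ
      have hκ : kappaVec κM ζ ∈ sDir 𝔥 := (kappaVec_mem_and_zEmb_mem_of_isIrred L cls κM M e hΘ hiso hcm1 hH hζ).1
      have := (mem_sAnn_iff.mp hξ) _ hκ
      rw [← this]
      simp only [hr, kappaVec, Finset.sum_mul, Finset.mul_sum]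
      rw [Finset.sum_comm]
      exact Finset.sum_congr rfl fun e' _ => Finset.sum_congr rfl fun b _ => by ring
    -- base change
    have hsat := ratHullCls_zProj_linSpace_eq L cls κM M e hΘ hiso hcm1 hH
    set S : Set (γ → ℚ) := {v | Rat.ratVec v ∈ 𝔷₀} with hS
    have h1 := Rat.mem_span_ratVec_of_forall_sum_eq_zero S (x := r) fun v hv => by
      rw [← hr0 _ hv]
      exact Finset.sum_congr rfl fun b _ => by rw [Rat.ratVec_apply, mul_comm]
    refine (Submodule.span_le.mpr ?_) h1
    rintro _ ⟨c, hc, rfl⟩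
    -- `c` kills all rational vectors of `𝔷₀`, hence `𝔷₀`
    have hczRel : c ∈ Kron.zRel 𝔷₀ := by
      rw [Kron.mem_zRel_iff]
      intro z hz
      have hzspan := le_span_intVec_of_ratHullCls_eq cls hsat hz
      -- the functional `z ↦ ∑ c_b z_b`
      let φ : (γ → ℂ) →ₗ[ℂ] ℂ :=
        { toFun := fun z => ∑ b, (c b : ℂ) * z b
          map_add' := fun z z' => by simp [mul_add, Finset.sum_add_distrib]
          map_smul' := fun a z => by simp [Finset.mul_sum, mul_left_comm] }
      have hφ : Submodule.span ℂ (intVec '' {v : γ → ℤ | intVec v ∈ 𝔷₀ ∧ ∃ i, ∀ b, cls b ≠ i → v b = 0}) ≤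
          LinearMap.ker φ := by
        refine Submodule.span_le.mpr ?_
        rintro _ ⟨v, ⟨hv, -⟩, rfl⟩
        rw [SetLike.mem_coe, LinearMap.mem_ker]
        show ∑ b, (c b : ℂ) * intVec v b = 0
        have hvS : (fun b => (v b : ℚ)) ∈ S := by
          show Rat.ratVec (fun b => (v b : ℚ)) ∈ 𝔷₀
          have : Rat.ratVec (fun b => (v b : ℚ)) = intVec v := by funext b; simp [intVec]
          rw [this]; exact hv
        have := hc _ hvS
        have h' : ((∑ b, (v b : ℚ) * c b : ℚ) : ℂ) = 0 := by rw [this]; simp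
        push_cast at h'
        rw [← h']
        exact Finset.sum_congr rfl fun b _ => by simp [intVec]; ring
      have := hφ hzspan
      rw [LinearMap.mem_ker] at this
      exact this
    -- hence so do its restrictions to the classes, which are classwise relations
    have hrestr : ∀ i, restr cls i c ∈ zRelCls cls 𝔷₀ := by
      intro i
      refine Submodule.subset_span ⟨?_, i, fun b hb => restr_apply_of_ne cls hb⟩
      rw [Kron.mem_zRel_iff]
      intro z hz
      have hzi := restrC_mem_of_ratHullCls_eq cls hsat hz i
      have h0 := (Kron.mem_zRel_iff.mp hczRel) _ hzi
      rw [← h0]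
      refine Finset.sum_congr rfl fun b _ => ?_
      rw [cast_restr]
      split_ifs <;> simp
    have hsum : (fun b => (c b : ℂ)) = ∑ i, fun b => ((restr cls i c b : ℚ) : ℂ) := by
      funext b
      rw [Finset.sum_apply]
      have h : c b = ∑ i, restr cls i c b := by
        conv_lhs => rw [← sum_restr cls c]
        simp only [Finset.sum_apply]
      rw [h, Rat.cast_sum]
    show Rat.ratVec c ∈ _
    have hrv : Rat.ratVec c = fun b => (c b : ℂ) := rfl
    rw [hrv, hsum]
    exact Submodule.sum_mem _ fun i _ => Submodule.subset_span ⟨restr cls i c, hrestr i, rfl⟩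

section Model₂

variable {N : ℕ} (M : AnalyticGroupModel (β ⊕ (γ ⊕ δ) → ℂ) N) (e : Option β × ThetaIdx γ δ ≃ Fin (N + 1))
variable (hΘ : ∀ J w, M.Θ (e J) w = theta L cls κM J w)
include hΘ

/-- **`Lie G' = 𝒯(H)`** for `K = linData H`. [folklore] -/
theorem tangent_linData (hiso : ∀ i j, i ≠ j → ¬ (L i).IsIsogenousTo (L j))
    (hcm1 : ∀ b b', cls b = cls b' → (L (cls b)).HasCM → b = b') {H : AddSubgroup (β ⊕ (γ ⊕ δ) → ℂ)}
    (hH : M.IsIrred (H : Set (β ⊕ (γ ⊕ δ) → ℂ))) :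
    (linData L cls κM M e hΘ hiso hcm1 hH).tangent = AnalyticGroupModel.linSpace (H : Set (β ⊕ (γ ⊕ δ) → ℂ)) := by
  classical
  have hcl := hH.isClosedG
  have hsat := ratHullCls_zProj_linSpace_eq L cls κM M e hΘ hiso hcm1 hH
  have hdec : ∀ w : β ⊕ (γ ⊕ δ) → ℂ, w = coords (yPart w) (0 : γ → ℂ) (sPart w) + coords (0 : β → ℂ) (zPart w) (0 : δ → ℂ) := by
    intro w
    conv_lhs => rw [← coords_yPart_zPart_sPart w]
    rw [← coords_add]
    simp
  ext w
  rw [SubgroupDataC.mem_tangent_iff]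
  constructor
  · rintro ⟨hA, hC, hΞ⟩
    have hz : zPart w ∈ (AnalyticGroupModel.linSpace (H : Set (β ⊕ (γ ⊕ δ) → ℂ))).map zProj := by
      have : zPart w ∈ KronFam.ratHullCls cls ((AnalyticGroupModel.linSpace (H : Set (β ⊕ (γ ⊕ δ) → ℂ))).map zProj) := by
        rw [← TZ_pureData_zRelCls cls, GaGmE.Std.SubgroupDataC.mem_TZ_iff]
        exact fun c hc => hC c hc
      rwa [hsat] at this
    have hy : yPart w ∈ yDir (AnalyticGroupModel.linSpace (H : Set (β ⊕ (γ ⊕ δ) → ℂ))) :=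
      (mem_yDir_iff_forall_yRelQ L cls κM M e hΘ hcl (yPart w)).mpr fun q hq => hA q hq
    have hs : sPart w ∈ sDir (AnalyticGroupModel.linSpace (H : Set (β ⊕ (γ ⊕ δ) → ℂ))) :=
      mem_of_forall_dotPerp fun ξ hξ => hΞ ξ hξ
    have h1 : coords (yPart w) (0 : γ → ℂ) (sPart w) ∈ AnalyticGroupModel.linSpace (H : Set (β ⊕ (γ ⊕ δ) → ℂ)) :=
      (mem_linSpace_iff_of_z_eq_zero L cls κM M e hΘ hcl (r := coords (yPart w) (0 : γ → ℂ) (sPart w)) (fun b => by simp)).mpr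
        ⟨by rw [yPart_coords_eq]; exact hy, by rw [sPart_coords_eq]; exact hs⟩
    have h2 := (kappaVec_mem_and_zEmb_mem_of_isIrred L cls κM M e hΘ hiso hcm1 hH hz).2
    rw [hdec w]
    exact Submodule.add_mem _ h1 h2
  · intro hw
    have hz : zPart w ∈ (AnalyticGroupModel.linSpace (H : Set (β ⊕ (γ ⊕ δ) → ℂ))).map zProj :=
      Submodule.mem_map_of_mem hw
    have h2 := (kappaVec_mem_and_zEmb_mem_of_isIrred L cls κM M e hΘ hiso hcm1 hH hz).2
    have h1 : coords (yPart w) (0 : γ → ℂ) (sPart w) ∈ AnalyticGroupModel.linSpace (H : Set (β ⊕ (γ ⊕ δ) → ℂ)) := by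
      have : coords (yPart w) (0 : γ → ℂ) (sPart w) = w - coords (0 : β → ℂ) (zPart w) (0 : δ → ℂ) := by
        rw [eq_sub_iff_add_eq]; exact (hdec w).symm
      rw [this]; exact Submodule.sub_mem _ hw h2
    have hys := (mem_linSpace_iff_of_z_eq_zero L cls κM M e hΘ hcl (r := coords (yPart w) (0 : γ → ℂ) (sPart w))
      (fun b => by simp)).mp h1
    rw [yPart_coords_eq, sPart_coords_eq] at hys
    refine ⟨fun q hq => ?_, fun c hc => ?_, fun ξ hξ => ?_⟩
    · exact ((mem_yDir_iff_forall_yRelQ L cls κM M e hΘ hcl (yPart w)).mp hys.1) q hq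
    · have : zPart w ∈ KronFam.ratHullCls cls ((AnalyticGroupModel.linSpace (H : Set (β ⊕ (γ ⊕ δ) → ℂ))).map zProj) :=
        KronFam.le_ratHullCls cls _ hz
      rw [← TZ_pureData_zRelCls cls, GaGmE.Std.SubgroupDataC.mem_TZ_iff] at this
      exact this c hc
    · exact (mem_sAnn_iff.mp hξ) _ hys.2

/-- **`H = Lie G' + ker exp`** for `K = linData H`: the classification of the closed irreducible
subgroups of `Lie M_κ,ℂ` for the `Θ`-topology, any number of elliptic factors, no complex
multiplication. [cite: NesterenkoPhilippon2001, Ch. 11 Thm. 4.1 (H₀ = T_e⁻¹(H))] -/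
theorem coe_eq_preimageSubgroup_linData (hiso : ∀ i j, i ≠ j → ¬ (L i).IsIsogenousTo (L j))
    (hcm1 : ∀ b b', cls b = cls b' → (L (cls b)).HasCM → b = b') {H : AddSubgroup (β ⊕ (γ ⊕ δ) → ℂ)}
    (hH : M.IsIrred (H : Set (β ⊕ (γ ⊕ δ) → ℂ))) :
    (H : Set (β ⊕ (γ ⊕ δ) → ℂ)) = preimageSubgroup L cls κM (linData L cls κM M e hΘ hiso hcm1 hH) ∧
      finrank ℂ (linData L cls κM M e hΘ hiso hcm1 hH).tangent + 1 ≤ M.coneDim (H : Set (β ⊕ (γ ⊕ δ) → ℂ)) := by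
  set K := linData L cls κM M e hΘ hiso hcm1 hH with hK
  set 𝔥 := AnalyticGroupModel.linSpace (H : Set (β ⊕ (γ ⊕ δ) → ℂ)) with h𝔥
  have hcl := hH.isClosedG
  have hT : K.tangent = 𝔥 := tangent_linData L cls κM M e hΘ hiso hcm1 hH
  -- the closure of the lineality space
  set Y := M.zeroSet ((M.vanishing (K.tangent : Set (β ⊕ (γ ⊕ δ) → ℂ)) : Ideal _) :
    Set (MvPolynomial (Fin (N + 1)) ℂ)) with hY
  have hYcl : M.IsClosedG Y := M.isClosedG_zeroSet _
  have h0Y : (0 : β ⊕ (γ ⊕ δ) → ℂ) ∈ Y := M.subset_zeroSet_vanishing _ K.tangent.zero_mem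
  have hYH : Y ⊆ H := by
    rw [← hcl.eq, hY, hT]
    exact M.zeroSet_antitone (M.vanishing_antitone (AnalyticGroupModel.linSpace_subset H))
  have hdimY : finrank ℂ K.tangent + 1 ≤ M.coneDim Y := by
    rw [hY, M.coneDim_zeroSet_vanishing]
    exact finrank_tangent_succ_le_coneDim L cls κM M e hΘ K.toOne
  have hdimH : M.coneDim (H : Set (β ⊕ (γ ⊕ δ) → ℂ)) ≤ finrank ℂ K.tangent + 1 := by
    rw [hT]; exact M.coneDim_le_finrank_linSpace_succ H hH
  have hYeq : Y = H := hH.eq_of_subset_of_coneDim_eq M hYcl ⟨0, h0Y⟩ hYH (hdimH.trans hdimY)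
  refine ⟨Set.Subset.antisymm ?_ ?_, ?_⟩
  · rw [← hYeq]
    exact zeroSet_vanishing_tangent_subset_preimageSubgroup L cls κM M e hΘ K
  · intro w hw
    have hle : preimageSubgroup L cls κM K ≤ H := by
      refine sup_le ?_ ((AddSubgroup.closure_le _).mpr (ker_subset_of_isClosedG L cls κM M e hΘ hcl))
      intro x hx
      have hx' : x ∈ 𝔥 := by rw [← hT]; exact hx
      exact AnalyticGroupModel.linSpace_subset H hx'
    exact hle hw
  · exact hdimY.trans (M.coneDim_mono hYH)

/-- **Classification of the `Θ`-closed irreducible subgroups** (pairwise non-isogenous lattices, CM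
classes with one block) — the hypothesis `hCL` of `philippon_shape_of_classification'` for a
general theta model. [cite: NesterenkoPhilippon2001, Ch. 11 Thm. 4.1] -/
theorem classification (hiso : ∀ i j, i ≠ j → ¬ (L i).IsIsogenousTo (L j))
    (hcm1 : ∀ b b', cls b = cls b' → (L (cls b)).HasCM → b = b') (H₀ : AddSubgroup (β ⊕ (γ ⊕ δ) → ℂ))
    (hH₀ : M.IsIrred (H₀ : Set (β ⊕ (γ ⊕ δ) → ℂ))) :
    ∃ K : SubgroupDataC β γ δ cls κM, (preimageSubgroup L cls κM K : Set (β ⊕ (γ ⊕ δ) → ℂ)) = H₀ ∧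
      AnalyticGroupModel.linSpace (↑H₀ : Set (β ⊕ (γ ⊕ δ) → ℂ)) = K.tangent ∧
      finrank ℂ K.tangent + 1 ≤ M.coneDim (↑H₀ : Set (β ⊕ (γ ⊕ δ) → ℂ)) := by
  obtain ⟨h1, h2⟩ := coe_eq_preimageSubgroup_linData L cls κM M e hΘ hiso hcm1 hH₀
  exact ⟨linData L cls κM M e hΘ hiso hcm1 hH₀, h1.symm, (tangent_linData L cls κM M e hΘ hiso hcm1 hH₀).symm, h2⟩

end Model₂

/-! ### Philippon's zero estimate for the family theta model; the discharge -/

end Std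

end GaGmEFam

set_option maxHeartbeats 800000 in
open GaGmEFam.Std in
/-- **Philippon's zero estimate (1986, Thm. 2.1) for the theta models of the `k`-lattice standard
models** `𝔾ₘ^β × P`, `P → ∏_b E_{cls b}` (pairwise non-isogenous lattices with algebraic
invariants, CM classes with one block): the hypothesis `hphil` of
`HuberWustholzManyCurvePeriods_of_philippon`, from the classification of the obstruction subgroups
(`GaGmEFam.Std.classification`) and `GaGmEFam.Std.philippon_shape_of_classification'`.
[cite: Philippon1986, Thm. 2.1] [cite: NesterenkoPhilippon2001, Ch. 11 Thm. 4.1] -/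
theorem philippon_family (𝓙 : Type) [Fintype 𝓙] [DecidableEq 𝓙] (L : 𝓙 → PeriodPair)
    (_hL : ∀ i, IsAlgebraic ℚ (L i).g₂ ∧ IsAlgebraic ℚ (L i).g₃)
    (hiso : ∀ i j, i ≠ j → ¬ (L i).IsIsogenousTo (L j))
    (β γ δ : Type) [Fintype β] [Fintype γ] [Fintype δ] [DecidableEq γ] (cls : γ → 𝓙)
    (hcm1 : ∀ b b', cls b = cls b' → (L (cls b)).HasCM → b = b') (κM : δ → γ → GaGmE.Kbar) :
    ∃ c : ℝ, 0 < c ∧ ∀ (𝔟 : Submodule ℂ (β ⊕ (γ ⊕ δ) → ℂ)) (v : β ⊕ (γ ⊕ δ) → ℂ)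
      (P : MvPolynomial (Option β × GaGmE.Std.ThetaIdx γ δ) ℂ) (D S T : ℕ),
      0 < Module.finrank ℂ 𝔟 → 1 ≤ D → 1 ≤ S → P.IsHomogeneous D → (∃ w, thetaEval L cls κM P w ≠ 0) →
      (∀ s : ℕ, s ≤ Fintype.card (β ⊕ (γ ⊕ δ)) * S →
        GaGmE.Std.VanishesAlong 𝔟 (thetaEval L cls κM P) ((s : ℂ) • v) (Fintype.card (β ⊕ (γ ⊕ δ)) * T + 1)) →
      ∃ K : SubgroupDataC β γ δ cls κM, (∃ w₀, ∀ w ∈ K.tangent, thetaEval L cls κM P (w₀ + w) = 0) ∧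
        (Nat.choose (T + (Module.finrank ℂ 𝔟 - Module.finrank ℂ ↥(𝔟 ⊓ K.tangent)))
            (Module.finrank ℂ 𝔟 - Module.finrank ℂ ↥(𝔟 ⊓ K.tangent)) : ℝ) *
          (orbitCard L cls κM K v S : ℝ) * (D : ℝ) ^ Module.finrank ℂ K.tangent ≤
          c * (D : ℝ) ^ Fintype.card (β ⊕ (γ ⊕ δ)) := by
  classical
  exact philippon_shape_of_classification' L cls κM fun H₀ hirr =>
    classification L cls κM (thetaModel L cls κM (hardData L cls κM)) (GaGmE.Std.idxEquiv β γ δ).symm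
      (Θ_thetaModel_symm L cls κM (hardData L cls κM)) hiso hcm1 H₀ hirr

/-- **DISCHARGE of the named fact `HuberWustholzManyCurvePeriods`** (Huber–Wüstholz, Cambridge
Tract 227, Thm. 15.3 (1) for `M = [ℤ →⁰ 𝔾ₘ] × E₁ × ⋯ × E_k`, pairwise non-isogenous curves with
algebraic invariants): the `ℚ̄`-linear relations among `1, 2πi` and the `ω₁, ω₂, η₁, η₂` of the
curves are generated curve by curve, and there are none for the non-CM curves. Proof: reduction
to the Baker–Wüstholz analytic subgroup theorem for the standard models (`ManyCurveClosing.lean`)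
and Philippon's zero estimate for their theta models (`philippon_family`).
[cite: HuberWustholz2022, Thm. 15.3 (1)] -/
theorem HuberWustholzManyCurvePeriods_holds : HuberWustholzManyCurvePeriods :=
  HuberWustholzManyCurvePeriods_of_philippon philippon_family

end Literature.NumberTheory.Transcendental

end
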